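import Summits.ResolutionOfSingularities.ResolutionOfSingularities.Theorems.FrobeniusClosingSteerRadicandChainRealisationTower
import Summits.ResolutionOfSingularities.ResolutionOfSingularities.Theorems.FrobeniusClosingSteerRadicandChainRealisationBase
import Literature.AlgebraicGeometry.Resolution.QuadraticTransforms
import Mathlib.RingTheory.IntegralClosure.IsIntegralClosure.Basic
import Mathlib.Algebra.CharP.Lemmas
import HarnessLib

/-!
# Steer σ-residual, LOW half — D3a part 2: the TORSOR tower `Y = A[T]`, `T² = h`, inside one field —
# a curve step is a proper partial normalisation; the torsor ring is local

OURS (campaign res-hironaka, rung L, slot W4.1, crux `Steer` stmt-ResolutionOfSingularities-16345; res-L0-w41-plan-1 RULINGS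
18d/19c/20b/24c «D3a LOW TOWER + MOVES», res-D-pv-012 AS res-L0-w41-stub-8; sibling of `FrobeniusClosingSteerLowTowerMoves.lean`).
Theses-free, definition-free; consumer = res-type-026's `TamedMixedBranch.tamedMixedBranchReduction` (p515978), whose step
hypothesis is «quadratic transform ∨ (Y ≤ Y′, Y ≠ Y′, Y′ local, every element of Y′ integral over Y)».
AI-produced; weaker than expert review; nothing here is a statement of the manuscript under review.

In ONE field `L` (binder; any field containing the surface germs `A` and a square root `T` of the radicand residue `h`):
* `closure_insert_eq_lift_range` / `isLocalRing_closure_insert` — `Y := A[T] = closure (A ∪ {T}) ⊆ L` is the image of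
  `A[X]/(X² − h)`, injectively when `h` is not a square of a fraction of `A` (026's `lift_injective_of_forall_pow_ne`), hence LOCAL
  when `h ≡ c² (mod 𝔪_A)` (026's `isLocalRing_adjoinRoot`);
* `curveStep_le`, `curveStep_integral` — (T2) CURVE step: `A` unchanged, `h − ḡ² = w̄²·h′`, `T′ = (T − ḡ)/w̄` (`T′² = h′`):
  `A[T] ≤ A[T′]` and every element of `A[T′]` is integral over `A[T]` (witness polynomials with coefficients in `A ⊆ A[T]`) —
  the «partial normalisation» disjunct of the consumer, up to properness `T′ ∉ A[T]`.
[cite: Cutkosky2014, §2.1] [cite: Lipman1978, (1.32)] [folklore]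
-/

noncomputable section

-- single-problem summit: the doubled namespace component `ResolutionOfSingularities` is forced
set_option linter.dupNamespace false

namespace Summit.ResolutionOfSingularities.ResolutionOfSingularities.Theorems.SwitchingDichotomy.LowTower

open IsLocalRing Polynomial
open Literature.AlgebraicGeometry.Resolution

variable {L : Type} [Field L]

/-! ## The torsor ring `A[T] ⊆ L` -/

/-- `T² = h ∈ A` makes `X² − C h` vanish at `T` under the inclusion `A ⊆ L`. [folklore] -/
theorem eval₂_sq_sub_eq_zero (A : Subring L) {T h : L} (hh : h ∈ A) (hT : T ^ 2 = h) :
    ((X : A[X]) ^ 2 - C (⟨h, hh⟩ : A)).eval₂ A.subtype T = 0 := by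
  simp [hT]

/-- `A[T] := closure (A ∪ {T})` is the range of `A[X]/(X² − h) → L`, `X ↦ T`. [folklore] -/
theorem closure_insert_eq_lift_range (A : Subring L) {T h : L} (hh : h ∈ A) (hT : T ^ 2 = h) :
    Subring.closure (insert T (A : Set L)) =
      (AdjoinRoot.lift A.subtype T (eval₂_sq_sub_eq_zero A hh hT)).range := by
  apply le_antisymm
  · refine Subring.closure_le.mpr (Set.insert_subset_iff.mpr ⟨?_, fun a ha => ?_⟩)
    · exact ⟨AdjoinRoot.root _, by simp⟩
    · exact ⟨AdjoinRoot.of _ ⟨a, ha⟩, by simp⟩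
  · refine RadicandChainRealisation.lift_range_le _ _ (fun s => ?_) ?_
    · exact Subring.subset_closure (Set.mem_insert_of_mem _ s.2)
    · exact Subring.subset_closure (Set.mem_insert _ _)

/-- **`A[T]` is a LOCAL ring** when `A ⊆ L` is a local subring of characteristic `2`, `T² = h ∈ A` with `h ≡ c²`
modulo `𝔪_A` (residue field perfect), and `h` is not the square of a fraction of `A` (the torsor generator is not a
fraction of the base — the core datum's non-square row read on the surface germ). OURS. [folklore] -/
theorem isLocalRing_closure_insert [CharP L 2] (A : Subring L) [IsLocalRing A] {T h : L} (hh : h ∈ A) (hT : T ^ 2 = h)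
    (c : A) (hc : (⟨h, hh⟩ : A) - c ^ 2 ∈ maximalIdeal A)
    (hnr : ∀ u v : A, (v : L) ≠ 0 → ((u : L) / (v : L)) ^ 2 ≠ h) :
    IsLocalRing (Subring.closure (insert T (A : Set L))) := by
  haveI : Fact (Nat.Prime 2) := ⟨Nat.prime_two⟩
  haveI : CharP A 2 := inferInstance
  have h0 := eval₂_sq_sub_eq_zero A hh hT
  have hinj : Function.Injective (AdjoinRoot.lift A.subtype T h0) :=
    RadicandChainRealisation.lift_injective_of_forall_pow_ne A.subtype Subtype.coe_injective ⟨h, hh⟩ T hT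
      (fun u v hv => hnr u v hv) h0
  haveI : IsLocalRing (AdjoinRoot ((X : A[X]) ^ 2 - C (⟨h, hh⟩ : A))) :=
    RadicandChainRealisation.isLocalRing_adjoinRoot _ c hc
  rw [closure_insert_eq_lift_range A hh hT]
  exact (RingEquiv.ofBijective (AdjoinRoot.lift A.subtype T h0).rangeRestrict
    ⟨fun a b hab => hinj (congrArg Subtype.val hab), RingHom.rangeRestrict_surjective _⟩).isLocalRing

/-! ## (T2) the curve step: a partial normalisation -/

/-- In characteristic `2`: `h − g² = w²·h′` and `T² = h`, `w ≠ 0` give `((T − g)/w)² = h′`. [folklore] -/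
theorem curveStep_sq [CharP L 2] {T h g w h' : L} (hT : T ^ 2 = h) (hrel : h - g ^ 2 = w ^ 2 * h') (hw : w ≠ 0) :
    ((T - g) / w) ^ 2 = h' := by
  haveI : Fact (Nat.Prime 2) := ⟨Nat.prime_two⟩
  rw [div_pow, sub_pow_char, hT, hrel]
  field_simp

/-- **(T2a) The curve step enlarges the torsor ring**: `A[T] ≤ A[T′]` for `T′ = (T − g)/w`, `g, w ∈ A` (`T = g + w·T′`).
[folklore] -/
theorem curveStep_le (A : Subring L) {T g w : L} (hg : g ∈ A) (hw : w ∈ A) (hw0 : w ≠ 0) :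
    Subring.closure (insert T (A : Set L)) ≤ Subring.closure (insert ((T - g) / w) (A : Set L)) := by
  refine Subring.closure_le.mpr (Set.insert_subset_iff.mpr ⟨?_, fun a ha => Subring.subset_closure
    (Set.mem_insert_of_mem _ ha)⟩)
  have hT : T = g + w * ((T - g) / w) := by field_simp; ring
  have hmem : g + w * ((T - g) / w) ∈ Subring.closure (insert ((T - g) / w) (A : Set L)) :=
    Subring.add_mem _ (Subring.subset_closure (Set.mem_insert_of_mem _ hg))
      (Subring.mul_mem _ (Subring.subset_closure (Set.mem_insert_of_mem _ hw))
        (Subring.subset_closure (Set.mem_insert _ _)))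
  rw [← hT] at hmem
  exact hmem

/-- **(T2b) Every element of `A[T′]` is INTEGRAL over `A[T]`** (indeed over `A`), `T′² = h′ ∈ A`: witnessed by a monic
polynomial over `L` with coefficients in `A[T]` — the shape of res-type-026's consumer. [folklore] -/
theorem curveStep_integral (A : Subring L) {T T' h' : L} (hh' : h' ∈ A) (hT' : T' ^ 2 = h') :
    ∀ z ∈ Subring.closure (insert T' (A : Set L)),
      ∃ q : L[X], q.Monic ∧ (∀ i, q.coeff i ∈ Subring.closure (insert T (A : Set L))) ∧ q.eval z = 0 := by
  intro z hz
  -- `z` is integral over `A` (inside `L`): `A[T′]` lies in the integral closure of `A`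
  have hT'int : IsIntegral A T' := by
    refine ⟨X ^ 2 - C (⟨h', hh'⟩ : A), (monic_X_pow _).sub_of_left (degree_C_le.trans_lt (by simp)), ?_⟩
    simp [hT']
    exact sub_eq_zero.mpr rfl
  have hle : Subring.closure (insert T' (A : Set L)) ≤ (integralClosure A L).toSubring := by
    refine Subring.closure_le.mpr (Set.insert_subset_iff.mpr ⟨hT'int, fun a ha => ?_⟩)
    exact isIntegral_algebraMap (R := A) (A := L) (x := ⟨a, ha⟩)
  obtain ⟨q, hqm, hqz⟩ : IsIntegral A z := hle hz
  refine ⟨q.map (algebraMap A L), hqm.map _, fun i => ?_, ?_⟩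
  · rw [coeff_map]
    exact Subring.subset_closure (Set.mem_insert_of_mem _ (q.coeff i).2)
  · rw [eval_map]; exact hqz

/-! ## Two-term normal form of `A[T]` and its non-units -/

/-- **Normal form**: `A[T] = A + A·T` when `T² ∈ A`. [folklore] -/
theorem mem_closure_insert_iff (A : Subring L) {T h : L} (hh : h ∈ A) (hT : T ^ 2 = h) (z : L) :
    z ∈ Subring.closure (insert T (A : Set L)) ↔ ∃ a ∈ A, ∃ b ∈ A, z = a + b * T := by
  constructor
  · intro hz
    induction hz using Subring.closure_induction with
    | mem z hz =>
      rcases hz with rfl | hz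
      · exact ⟨0, A.zero_mem, 1, A.one_mem, by ring⟩
      · exact ⟨z, hz, 0, A.zero_mem, by ring⟩
    | zero => exact ⟨0, A.zero_mem, 0, A.zero_mem, by ring⟩
    | one => exact ⟨1, A.one_mem, 0, A.zero_mem, by ring⟩
    | add z w _ _ hz hw =>
      obtain ⟨a, ha, b, hb, rfl⟩ := hz
      obtain ⟨c, hc, d, hd, rfl⟩ := hw
      exact ⟨a + c, A.add_mem ha hc, b + d, A.add_mem hb hd, by ring⟩
    | neg z _ hz =>
      obtain ⟨a, ha, b, hb, rfl⟩ := hz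
      exact ⟨-a, A.neg_mem ha, -b, A.neg_mem hb, by ring⟩
    | mul z w _ _ hz hw =>
      obtain ⟨a, ha, b, hb, rfl⟩ := hz
      obtain ⟨c, hc, d, hd, rfl⟩ := hw
      refine ⟨a * c + b * d * h, A.add_mem (A.mul_mem ha hc) (A.mul_mem (A.mul_mem hb hd) hh), a * d + b * c,
        A.add_mem (A.mul_mem ha hd) (A.mul_mem hb hc), ?_⟩
      have : T * T = h := by rw [← hT]; ring
      linear_combination (b * d) * this
  · rintro ⟨a, ha, b, hb, rfl⟩
    exact Subring.add_mem _ (Subring.subset_closure (Set.mem_insert_of_mem _ ha))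
      (Subring.mul_mem _ (Subring.subset_closure (Set.mem_insert_of_mem _ hb))
        (Subring.subset_closure (Set.mem_insert _ _)))

/-- A non-unit of the local base `A` whose square... : if `x̄ ∈ 𝔪_A` were a unit of `A[T]`, writing `x̄⁻¹ = a + b·T` gives
`(1 − a x̄)² = b² x̄² h`, i.e. `1 ∈ 𝔪_A` — so **non-units of `A` stay non-units in `A[T]`** (`T² = h ∈ A`, `T ∉ Frac A`).
[folklore] -/
theorem inv_not_mem_closure_insert (A : Subring L) [IsLocalRing A] {T h : L} (hh : h ∈ A) (hT : T ^ 2 = h)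
    (hnr : ∀ u v : A, (v : L) ≠ 0 → ((u : L) / (v : L)) ^ 2 ≠ h)
    {x : L} (hxA : x ∈ A) (hxm : (⟨x, hxA⟩ : A) ∈ maximalIdeal A) (hx0 : x ≠ 0) :
    x⁻¹ ∉ Subring.closure (insert T (A : Set L)) := by
  intro hxi
  obtain ⟨a, ha, b, hb, hab⟩ := (mem_closure_insert_iff A hh hT _).mp hxi
  -- `1 - a x = b x T`
  have h1 : 1 - a * x = b * x * T := by
    have := congrArg (fun z => z * x) hab
    simp only [inv_mul_cancel₀ hx0] at this
    linear_combination this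
  by_cases hb0 : b = 0
  · -- then `a x = 1`, `x` a unit of `A`
    rw [hb0, zero_mul, zero_mul, sub_eq_zero] at h1
    apply (IsLocalRing.mem_maximalIdeal _).mp hxm
    have hxa : x⁻¹ = a := (eq_inv_of_mul_eq_one_left h1.symm).symm
    refine (isUnit_subring_iff_inv_mem _).mpr ⟨hx0, ?_⟩
    change x⁻¹ ∈ A
    rw [hxa]; exact ha
  · -- then `T = (1 - a x)/(b x)` is a fraction of `A` with square `h`
    have hbx : b * x ≠ 0 := mul_ne_zero hb0 hx0
    apply hnr ⟨1 - a * x, A.sub_mem A.one_mem (A.mul_mem ha hxA)⟩ ⟨b * x, A.mul_mem hb hxA⟩ hbx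
    change ((1 - a * x) / (b * x)) ^ 2 = h
    rw [h1, mul_div_cancel_left₀ _ hbx, hT]

/-- An element of `𝔪_A` is a non-unit of `A[T]` (subring form of `inv_not_mem_closure_insert`). [folklore] -/
theorem mem_maximalIdeal_closure_insert (A : Subring L) [IsLocalRing A] {T h : L} (hh : h ∈ A) (hT : T ^ 2 = h)
    (hnr : ∀ u v : A, (v : L) ≠ 0 → ((u : L) / (v : L)) ^ 2 ≠ h)
    [IsLocalRing (Subring.closure (insert T (A : Set L)))]
    {m : L} (hmA : m ∈ A) (hmm : (⟨m, hmA⟩ : A) ∈ maximalIdeal A) :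
    (⟨m, Subring.subset_closure (Set.mem_insert_of_mem _ hmA)⟩ : Subring.closure (insert T (A : Set L))) ∈
      maximalIdeal (Subring.closure (insert T (A : Set L))) := by
  rw [IsLocalRing.mem_maximalIdeal, mem_nonunits_iff]
  intro hu
  rw [isUnit_subring_iff_inv_mem] at hu
  exact inv_not_mem_closure_insert A hh hT hnr hmA hmm hu.1 hu.2

/-- **Non-units of `A[T]` have the form `m + b·(T − g)`, `m ∈ 𝔪_A`, `b ∈ A`** (`g ∈ A` a residue square root:
`T − g` a non-unit). [folklore] -/
theorem exists_eq_of_nonunit (A : Subring L) [IsLocalRing A] {T h g : L} (hh : h ∈ A) (hT : T ^ 2 = h) (hg : g ∈ A)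
    [IsLocalRing (Subring.closure (insert T (A : Set L)))]
    (hTg : ¬ IsUnit (⟨T - g, Subring.sub_mem _ (Subring.subset_closure (Set.mem_insert _ _))
      (Subring.subset_closure (Set.mem_insert_of_mem _ hg))⟩ : Subring.closure (insert T (A : Set L))))
    {y : L} (hy : y ∈ Subring.closure (insert T (A : Set L)))
    (hyu : ¬ IsUnit (⟨y, hy⟩ : Subring.closure (insert T (A : Set L)))) :
    ∃ m, ∃ hm : m ∈ A, (⟨m, hm⟩ : A) ∈ maximalIdeal A ∧ ∃ b ∈ A, y = m + b * (T - g) := by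
  set Y := Subring.closure (insert T (A : Set L)) with hYdef
  obtain ⟨a, ha, b, hb, rfl⟩ := (mem_closure_insert_iff A hh hT _).mp hy
  refine ⟨a + b * g, A.add_mem ha (A.mul_mem hb hg), ?_, b, hb, by ring⟩
  by_contra hunit
  have hu : IsUnit (⟨a + b * g, A.add_mem ha (A.mul_mem hb hg)⟩ : A) := IsLocalRing.notMem_maximalIdeal.mp hunit
  -- then `a + bT = (a + b g) + b (T - g)` is a unit of `Y`
  have hAY : A ≤ Y := fun z hz => Subring.subset_closure (Set.mem_insert_of_mem _ hz)
  have huY : IsUnit (⟨a + b * g, hAY (A.add_mem ha (A.mul_mem hb hg))⟩ : Y) := by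
    obtain ⟨hne, hinv⟩ := (isUnit_subring_iff_inv_mem _).mp hu
    exact (isUnit_subring_iff_inv_mem _).mpr ⟨hne, hAY hinv⟩
  have hbY : (⟨b, hAY hb⟩ : Y) * ⟨T - g, Y.sub_mem (Subring.subset_closure (Set.mem_insert _ _))
      (Subring.subset_closure (Set.mem_insert_of_mem _ hg))⟩ ∈ maximalIdeal Y :=
    Ideal.mul_mem_left _ _ ((IsLocalRing.mem_maximalIdeal _).mpr hTg)
  apply hyu
  have heq : (⟨a + b * T, hy⟩ : Y) = ⟨a + b * g, hAY (A.add_mem ha (A.mul_mem hb hg))⟩ +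
      ⟨b, hAY hb⟩ * ⟨T - g, Y.sub_mem (Subring.subset_closure (Set.mem_insert _ _))
        (Subring.subset_closure (Set.mem_insert_of_mem _ hg))⟩ := Subtype.ext (by simp; ring)
  rw [heq]
  by_contra hnu
  have hmem : _ ∈ maximalIdeal Y := (IsLocalRing.mem_maximalIdeal _).mpr hnu
  have := (maximalIdeal Y).sub_mem hmem hbY
  simp only [add_sub_cancel_right] at this
  exact (IsLocalRing.mem_maximalIdeal _).mp this huY

/-! ## (T1) the point step: a quadratic transform of the torsor ring -/

/-- **(T1) A POINT step of the LOW game is a quadratic transform of the torsor ring.**  In one field `L` of characteristic `2`: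
`A ≤ A′` local subrings with `A′` a quadratic transform of `A` in the chart of `x ∈ 𝔪_A` (explicit data: `A[𝔪_A/x] ≤ A′`, every
element of `A′` a fraction over `A[𝔪_A/x]` with denominator inverted in `A′`, `A′` dominates `A`); radicands `h ∈ A`, `h′ ∈ A′`,
`g ∈ A` with `h′·x² = h − g²`; `T² = h`, `T′ := (T − g)/x`; `h` resp. `h′` not a square of a fraction of `A` resp. `A′` (run
hygiene: the torsor generator is not a fraction of the member); `h′ ≡ c′²` modulo `𝔪_{A′}` (perfect residue field).  Then
`A′[T′]` is a quadratic transform of `A[T]`, with the same exceptional parameter `x`. OURS. [cite: Cutkosky2014, §2.1] [folklore] -/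
theorem pointStep_isQuadraticTransform [CharP L 2] (A A' : Subring L) [IsLocalRing A] [IsLocalRing A'] (hAA' : A ≤ A')
    (x : L) (hxA : x ∈ A) (hxm : (⟨x, hxA⟩ : A) ∈ maximalIdeal A) (hx0 : x ≠ 0) (hbl : blowupRing A x ≤ A')
    (hfrac : ∀ z ∈ A', ∃ a ∈ blowupRing A x, ∃ b ∈ blowupRing A x, b⁻¹ ∈ A' ∧ z = a / b)
    (hdom : SubringDominates A A')
    {T h g h' : L} (hh : h ∈ A) (hg : g ∈ A) (hh' : h' ∈ A') (hT : T ^ 2 = h) (hrel : h' * x ^ 2 = h - g ^ 2)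
    (hnr : ∀ u v : A, (v : L) ≠ 0 → ((u : L) / (v : L)) ^ 2 ≠ h)
    (hnr' : ∀ u v : A', (v : L) ≠ 0 → ((u : L) / (v : L)) ^ 2 ≠ h')
    (c' : A') (hc' : (⟨h', hh'⟩ : A') - c' ^ 2 ∈ maximalIdeal A') :
    IsQuadraticTransform (Subring.closure (insert T (A : Set L))) (Subring.closure (insert ((T - g) / x) (A' : Set L))) := by
  haveI : Fact (Nat.Prime 2) := ⟨Nat.prime_two⟩
  set Y := Subring.closure (insert T (A : Set L)) with hYdef
  set T' := (T - g) / x with hT'def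
  set Y' := Subring.closure (insert T' (A' : Set L)) with hY'def
  have hrel' : h - g ^ 2 = x ^ 2 * h' := by rw [← hrel]; ring
  have hT' : T' ^ 2 = h' := curveStep_sq hT hrel' hx0
  -- `h − g² ∈ 𝔪_A`
  have hxA' : (⟨x, hAA' hxA⟩ : A') ∈ maximalIdeal A' := by
    rw [IsLocalRing.mem_maximalIdeal, mem_nonunits_iff]
    intro hu
    rw [isUnit_subring_iff_inv_mem] at hu
    exact (IsLocalRing.mem_maximalIdeal _).mp hxm ((isUnit_subring_iff_inv_mem _).mpr ⟨hx0, hdom.2 _ hxA hu.2⟩)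
  have hcA : (⟨h, hh⟩ : A) - ⟨g, hg⟩ ^ 2 ∈ maximalIdeal A := by
    rw [IsLocalRing.mem_maximalIdeal, mem_nonunits_iff]
    intro hu
    rw [isUnit_subring_iff_inv_mem] at hu
    -- `h - g² = x² h'` is a non-unit of `A'`, hence of `A`
    have hmem' : (⟨h - g ^ 2, hAA' (A.sub_mem hh (A.pow_mem hg 2))⟩ : A') ∈ maximalIdeal A' := by
      have : (⟨h - g ^ 2, hAA' (A.sub_mem hh (A.pow_mem hg 2))⟩ : A') = ⟨x, hAA' hxA⟩ * (⟨x, hAA' hxA⟩ * ⟨h', hh'⟩) :=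
        Subtype.ext (by simp [hrel']; ring)
      rw [this]
      exact Ideal.mul_mem_right _ _ hxA'
    have hinv : (h - g ^ 2)⁻¹ ∈ A := hdom.2 _ (A.sub_mem hh (A.pow_mem hg 2)) (hAA' (hdom.2 _ (A.sub_mem hh (A.pow_mem hg 2)) ?_))
    · exact (IsLocalRing.mem_maximalIdeal _).mp hmem' ((isUnit_subring_iff_inv_mem _).mpr ⟨hu.1, hAA' hinv⟩)
    · exact hAA' hu.2
  haveI hYloc : IsLocalRing Y := isLocalRing_closure_insert A hh hT ⟨g, hg⟩ hcA hnr
  haveI hY'loc : IsLocalRing Y' := isLocalRing_closure_insert A' hh' hT' c' hc' hnr'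
  have hAY : A ≤ Y := fun z hz => Subring.subset_closure (Set.mem_insert_of_mem _ hz)
  have hA'Y' : A' ≤ Y' := fun z hz => Subring.subset_closure (Set.mem_insert_of_mem _ hz)
  have hTY : T ∈ Y := Subring.subset_closure (Set.mem_insert _ _)
  have hT'Y' : T' ∈ Y' := Subring.subset_closure (Set.mem_insert _ _)
  have hYY' : Y ≤ Y' := by
    rw [hYdef]
    exact (curveStep_le A hg hxA hx0).trans (Subring.closure_mono (Set.insert_subset_insert hAA'))
  -- `x` and `T - g` are non-units of `Y`
  have hxY : (⟨x, hAY hxA⟩ : Y) ∈ maximalIdeal Y := mem_maximalIdeal_closure_insert A hh hT hnr hxA hxm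
  have hTg : ¬ IsUnit (⟨T - g, Y.sub_mem hTY (hAY hg)⟩ : Y) := by
    intro hu
    -- `(T - g)² = h - g² ∈ 𝔪_A` would be a unit of `Y`
    have hsq : IsUnit ((⟨T - g, Y.sub_mem hTY (hAY hg)⟩ : Y) ^ 2) := hu.pow 2
    have heq : (⟨T - g, Y.sub_mem hTY (hAY hg)⟩ : Y) ^ 2 = ⟨h - g ^ 2, hAY (A.sub_mem hh (A.pow_mem hg 2))⟩ :=
      Subtype.ext (by simp [sub_pow_char, hT])
    rw [heq] at hsq
    exact (IsLocalRing.mem_maximalIdeal _).mp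
      (mem_maximalIdeal_closure_insert A hh hT hnr (A.sub_mem hh (A.pow_mem hg 2)) hcA) hsq
  -- `A[𝔪_A/x] ≤ Y[𝔪_Y/x]`
  have hblY : blowupRing A x ≤ blowupRing Y x := by
    refine Subring.closure_le.mpr ?_
    rintro z (hz | ⟨m, hm, rfl⟩)
    · exact le_blowupRing Y x (hAY hz)
    · exact div_mem_blowupRing x (mem_maximalIdeal_closure_insert A hh hT hnr m.2 hm)
  have hT'bl : T' ∈ blowupRing Y x :=
    div_mem_blowupRing x ((IsLocalRing.mem_maximalIdeal _).mpr hTg)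
  refine ⟨hYloc, ⟨x, hAY hxA⟩, hxY, fun h0 => hx0 (congrArg Subtype.val h0), hY'loc, ?_, ?_, ?_⟩
  · -- `Y[𝔪_Y/x] ≤ Y'`
    refine Subring.closure_le.mpr ?_
    rintro z (hz | ⟨y, hy, rfl⟩)
    · exact hYY' hz
    · obtain ⟨m, hmA, hmm, b, hb, hyeq⟩ :=
        exists_eq_of_nonunit A hh hT hg hTg y.2 ((IsLocalRing.mem_maximalIdeal _).mp hy)
      have : (y : L) / x = m / x + b * T' := by
        rw [hyeq, hT'def]; field_simp
      show (y : L) / x ∈ Y'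
      rw [this]
      exact Y'.add_mem (hA'Y' (hbl (div_mem_blowupRing x hmm))) (Y'.mul_mem (hA'Y' (hAA' hb)) hT'Y')
  · -- fractions
    intro z hz
    obtain ⟨a', ha', b', hb', rfl⟩ := (mem_closure_insert_iff A' hh' hT' _).mp hz
    -- representatives with non-zero denominators
    have hrep : ∀ w ∈ A', ∃ a ∈ blowupRing A x, ∃ b ∈ blowupRing A x, b ≠ 0 ∧ b⁻¹ ∈ A' ∧ w = a / b := by
      intro w hw
      obtain ⟨a, ha, b, hb, hbi, rfl⟩ := hfrac w hw
      by_cases hb0 : b = 0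
      · exact ⟨0, Subring.zero_mem _, 1, Subring.one_mem _, one_ne_zero, by rw [inv_one]; exact A'.one_mem,
          by rw [hb0, div_zero, zero_div]⟩
      · exact ⟨a, ha, b, hb, hb0, hbi, rfl⟩
    obtain ⟨a₁, ha₁, b₁, hb₁, hb₁0, hb₁i, rfl⟩ := hrep a' ha'
    obtain ⟨a₂, ha₂, b₂, hb₂, hb₂0, hb₂i, rfl⟩ := hrep b' hb'
    refine ⟨a₁ * b₂ + a₂ * b₁ * T', ?_, b₁ * b₂, (blowupRing Y x).mul_mem (hblY hb₁) (hblY hb₂), ?_, ?_⟩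
    · exact (blowupRing Y x).add_mem ((blowupRing Y x).mul_mem (hblY ha₁) (hblY hb₂))
        ((blowupRing Y x).mul_mem ((blowupRing Y x).mul_mem (hblY ha₂) (hblY hb₁)) hT'bl)
    · rw [mul_inv]; exact Y'.mul_mem (hA'Y' hb₁i) (hA'Y' hb₂i)
    · field_simp
  · -- domination
    refine ⟨hYY', fun y hy hyi => ?_⟩
    by_contra hcon
    by_cases hy0 : y = 0
    · exact hcon (by rw [hy0, inv_zero]; exact Y.zero_mem)
    have hyu : ¬ IsUnit (⟨y, hy⟩ : Y) := fun hu => hcon ((isUnit_subring_iff_inv_mem _).mp hu).2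
    obtain ⟨m, hmA, hmm, b, hb, hyeq⟩ := exists_eq_of_nonunit A hh hT hg hTg hy hyu
    -- `y = m + b x T'` is a non-unit of `Y'`
    have hmA' : (⟨m, hAA' hmA⟩ : A') ∈ maximalIdeal A' := by
      rw [IsLocalRing.mem_maximalIdeal, mem_nonunits_iff]
      intro hu
      rw [isUnit_subring_iff_inv_mem] at hu
      exact (IsLocalRing.mem_maximalIdeal _).mp hmm ((isUnit_subring_iff_inv_mem _).mpr ⟨hu.1, hdom.2 _ hmA hu.2⟩)
    have hmY' : (⟨m, hA'Y' (hAA' hmA)⟩ : Y') ∈ maximalIdeal Y' := mem_maximalIdeal_closure_insert A' hh' hT' hnr' _ hmA'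
    have hxY' : (⟨x, hA'Y' (hAA' hxA)⟩ : Y') ∈ maximalIdeal Y' := mem_maximalIdeal_closure_insert A' hh' hT' hnr' _ hxA'
    have hyY' : (⟨y, hYY' hy⟩ : Y') ∈ maximalIdeal Y' := by
      have heq : (⟨y, hYY' hy⟩ : Y') = ⟨m, hA'Y' (hAA' hmA)⟩ +
          ⟨x, hA'Y' (hAA' hxA)⟩ * (⟨b, hA'Y' (hAA' hb)⟩ * ⟨T', hT'Y'⟩) :=
        Subtype.ext (by simp [hyeq, hT'def]; field_simp)
      rw [heq]
      exact Ideal.add_mem _ hmY' (Ideal.mul_mem_right _ _ hxY')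
    have hyu' : ¬ IsUnit (⟨y, hYY' hy⟩ : Y') := (IsLocalRing.mem_maximalIdeal _).mp hyY'
    exact hyu' ((isUnit_subring_iff_inv_mem _).mpr ⟨hy0, hyi⟩)

end Summit.ResolutionOfSingularities.ResolutionOfSingularities.Theorems.SwitchingDichotomy.LowTower

end
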